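import Summits.AtomisticToContinuum.BoseEinsteinCondensation.Theses.BECRiccatiGhostPlasma

/-!
# Birth skeleton (BC3) for crux `PairKernelSplit` — stmt-AtomisticToContinuum-13507
(route `BECRiccatiGhostPlasma`, rank 4; sub-problem `BoseEinsteinCondensation`)

Planner `planner-skel-stmt-AtomisticToContinuum-13507-0`, 2026-08-17 (skeleton-register, re-audit bin
REPAIRABLE). Published as `Cruxes/PairKernelSplit/Lines/birth.lean`; line card `Lines/birth.md`.

The crux: for bounded admissible `v` and every `ε > 0`, at all small `ρ`, eventually in `m`, the
Hoeffding (uniform-measure) pair projection `u_H(x,z) = L^{-3m}∫_{cell^m} S(x,z,W) dW` of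
`S = -log Ψ` for every EXACT positive translation-invariant ground state `Ψ` of `N = m+2` bosons
splits as `u_H(x,z) = c + p(x-z) + w(x-z)`, `p, w` continuous, `sup |p| ≤ ε`, `ρ∫_cell |w| ≤ ε`.

THE CUT (infrared / ultraviolet, made canonical by the clamp). With `f := u_H(·,0)` and
`c := f(centre)`, put `p := clamp_ε(f - c) = max(-ε, min(ε, f - c))` and `w := (f - c) - p`: then
`sup |p| ≤ ε` holds identically, `|w| ≤ |f - c|`, and `w = 0` wherever `|f - c| ≤ ε`. Hence the
crux follows from three statements about `f` alone, none of which mentions a decomposition: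

* `stub_hoeffdingReduction : HoeffdingReduction` — translation invariance: `u_H(x,z) = f(x-z)` with
  `f` continuous (shift `W ↦ W - z` on `(ℝ³/Lℤ³)^m`, `integral_cellN_comp_equivariant`; parametric
  continuity of `∫_{cell^m} -log Re Ψ(y,0,W) dW`). Provable now, size M.
* `stub_tailFlatness : TailFlatness` — the INFRARED half (hardest): for some core schedule
  `R(ρ)` with `ρR(ρ)³ → 0` (a core holding `o(1)` particles), `|f(z) - f(centre)| ≤ ε` for every
  `z` of the cell at flat-torus distance `≥ R(ρ)` from the origin, uniformly in `m` (expected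
  `|f - c_∞| ≲ a/r` on `a ≪ r ≪ ξ`, `≲ b/r²` beyond the healing length, `b = π^{-3/2}(a/ρ)^{1/2}`,
  so a CONSTANT schedule `R = O(a/ε)` already works if the tadpoles `ρ∫u₃` are finite — the route's
  why-might-fail: a `log L` drift of the tail kills it).
* `stub_coreSmallness : CoreSmallness` — the ULTRAVIOLET half: for EVERY core schedule with
  `ρR³ → 0`, `ρ ∫⁻_{cell ∩ {torus dist < R(ρ)}} |f - f(centre)| ≤ ε` at small `ρ`, eventually in `m`
  (lower Lebesgue integral: no integrability side condition, no junk value; expected size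
  `ρ(a³‖u₂‖_∞ + aR² + bR) → 0` — uniform-in-`N` local boundedness of the oscillation of the pair
  kernel of the many-body ground state, unproved).

Composition `PairKernelSplit_of : HoeffdingReduction → TailFlatness → CoreSmallness → PairKernelSplit`
(hypotheses spelled `__Registered.stub_X`, `rfl`-aliases keyed by the stub names, for the native
skeleton audit) is proved below WITHOUT `sorry`: `ρ₀ := min`, eventual-`m` sets intersected,
`∫_cell |w| = (∫⁻_cell ‖w‖ₑ).toReal` (`integral_norm_eq_lintegral_enorm`), pointwise on the cell
`‖w‖ₑ ≤ 1_core·‖f - c‖ₑ` (clamp facts + (T) off the core), `setLIntegral_mono'` +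
`setLIntegral_indicator`, then (C) and `ℝ≥0∞ → ℝ` bookkeeping; the identity is `ring` after (R).
It concludes the route decl `…Theses.BECRiccatiGhostPlasma.PairKernelSplit` BY NAME.

Why no stub is the crux or the summit in costume: (R) carries no smallness; (T) is a sup-norm
statement OFF a core and says nothing about `L¹`; (C) is an `L¹` statement ON the core and says
nothing pointwise; the crux needs all three, and conversely implies none of them (it does not pin
`c = f(centre)`, nor any core). BC3 probes (planner folder `bc/<Stub>_probe.lean`, vocabulary +
stub statements only): for each `S ∈ {HoeffdingReduction, TailFlatness, CoreSmallness}` both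
`S → PairKernelSplit` and `S → _root_.BoseEinsteinCondensation` by
`first | exact? | simpa [S] | (unfold S; simpa) | aesop`, and by each alternative alone — 30/30 FAIL
(`exact?`: "could not close the goal"; `simpa`: "Tactic `assumption` failed"; `aesop`: "failed to
prove the goal after exhaustive search"). This file: `lean check --json` rc 0, errors [], sorries 3 =
the three `stub_*` (the only `declaration uses sorry` warnings), `#print axioms PairKernelSplit_of`
= [propext, Classical.choice, Quot.sound].

Disproof used: none relevant — no `Cruxes/PairKernelSplit/Disproof.lean`, no landed
`Theorems/PairKernelSplit/Negative/*`, no dead lines (`ledger crux ls`: no workfiles, 2026-08-17).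
Refuter crux-attack (2026-08-15, item evidence `Witness.lean`/`BRIEFING.md`): survives; `v ≡ 0`
witness. Degenerate audit of the stubs: `v ≡ 0` (constant ground state) gives `f` constant, so (R)
holds, (T) holds with `R ≡ 1`, (C) with integrand `0`; `m = 0`: `cell^0` is a point, `u_H = S(x,z)`.
-/

noncomputable section

namespace Summit.AtomisticToContinuum.BoseEinsteinCondensation.Cruxes.PairKernelSplit.Birth

open MeasureTheory Filter Metric
open scoped ENNReal NNReal Topology
open Literature.MathematicalPhysics.QuantumManyBody.BoseGas
open Summit.AtomisticToContinuum.BoseEinsteinCondensation.Theses.BECRiccatiGhostPlasma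

/-! ## Vocabulary of the line -/

/-- The Hoeffding (uniform-measure) pair projection
`u_H(x,z) = L^{-3m} ∫_{cell^m} S(x,z,W) dW` of `S = -log Ψ` for `N = m+2` bosons on the torus of
side `L = ((m+2)/ρ)^{1/3}`, written literally as in the crux (`(ρ/(m+2))^m = L^{-3m}`). -/
def hoeffdingPair (ρ : ℝ) (m : ℕ) (Ψ : PeriodicTrialState (m + 2) (sideLength ρ (m + 2)))
    (x z : Space) : ℝ :=
  (ρ / ((m : ℝ) + 2)) ^ m *
    (∫ W in cellN m (sideLength ρ (m + 2)),
      -Real.log ((Ψ.ψ (Matrix.vecCons x (Matrix.vecCons z W))).re))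

/-- The reduced (one-body) pair kernel `f(y) = u_H(y, 0)`. -/
def pairFn (ρ : ℝ) (m : ℕ) (Ψ : PeriodicTrialState (m + 2) (sideLength ρ (m + 2)))
    (y : Space) : ℝ :=
  hoeffdingPair ρ m Ψ y 0

/-- The standing hypotheses of the crux on `Ψ`: an EXACT ground state (`⟨Ψ,HΨ⟩ = E₀`), positive
(`Ψ > 0`, real) and translation invariant. -/
def IsPosTIGroundState (v : ℝ → ℝ≥0∞) (ρ : ℝ) (m : ℕ)
    (Ψ : PeriodicTrialState (m + 2) (sideLength ρ (m + 2))) : Prop :=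
  periodicEnergy v Ψ = periodicGroundStateEnergy v (m + 2) (sideLength ρ (m + 2)) ∧
    (∀ X, 0 < (Ψ.ψ X).re ∧ (Ψ.ψ X).im = 0) ∧
    ∀ (a : Space) (X : Config (m + 2)), Ψ.ψ (fun i => X i + a) = Ψ.ψ X

/-- The vertices `{0, L}³` of the cell `[0,L)³` (the lattice points adjacent to the cell). -/
def corners (L : ℝ) : Set Space :=
  {n | ∀ k, n k = 0 ∨ n k = L}

/-- Flat-torus distance of `z ∈ [0,L)³` from the origin `0 ∈ ℝ³/Lℤ³`: the distance to the nearest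
vertex of the cell. -/
def torusNorm (L : ℝ) (z : Space) : ℝ :=
  infDist z (corners L)

/-- The centre `(L/2, L/2, L/2)` of the cell — the point of the torus farthest from the origin; the
value `f(centre)` is the reference constant `c` of the split. -/
def centre (L : ℝ) : Space :=
  WithLp.toLp 2 fun _ => L / 2

/-- Admissible core schedules: a core radius `R(ρ) > 0` enclosing a vanishing expected number of
particles, `ρ R(ρ)³ → 0` as `ρ → 0⁺` (sub-interparticle cores; e.g. `R` constant, or `R ∝ ρ^{-1/4}`). -/
def IsCoreSchedule (R : ℝ → ℝ) : Prop :=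
  (∀ ρ, 0 < ρ → 0 < R ρ) ∧ Tendsto (fun ρ => ρ * R ρ ^ 3) (𝓝[>] 0) (𝓝 0)

/-- The sup-small piece of the split: the clamp `p = max(-ε, min(ε, f - c))` of `f - c` at level `ε`. -/
def tailPart (ε : ℝ) (g : Space → ℝ) (c : ℝ) (y : Space) : ℝ :=
  max (-ε) (min ε (g y - c))

/-- The `L¹`-small piece of the split: the excess `w = (f - c) - p` of `f - c` over level `ε`. -/
def corePart (ε : ℝ) (g : Space → ℝ) (c : ℝ) (y : Space) : ℝ :=
  (g y - c) - tailPart ε g c y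

/-! ## Stub statements -/

/-- **Stub R — Hoeffding reduction (translation invariance; provable now, size M).** For a positive,
translation-invariant periodic state the Hoeffding pair projection is a continuous function of the
separation only: `u_H(x,z) = f(x - z)` with `f = u_H(·,0)` continuous. (Shift `W ↦ W - z` on the
torus `(ℝ³/Lℤ³)^m` — `integral_cellN_comp_equivariant` with unit Jacobian — and continuity of a
parametric integral of the continuous integrand `-log Re Ψ` over the bounded cell.) -/
def HoeffdingReduction : Prop :=
  ∀ (ρ : ℝ) (m : ℕ) (Ψ : PeriodicTrialState (m + 2) (sideLength ρ (m + 2))), 0 < ρ →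
    (∀ X, 0 < (Ψ.ψ X).re ∧ (Ψ.ψ X).im = 0) →
    (∀ (a : Space) (X : Config (m + 2)), Ψ.ψ (fun i => X i + a) = Ψ.ψ X) →
    Continuous (pairFn ρ m Ψ) ∧
      ∀ x z : Space, hoeffdingPair ρ m Ψ x z = pairFn ρ m Ψ (x - z)

/-- **Stub T — tail flatness (infrared half; the hard stub).** For bounded admissible `v` and
`ε > 0` there is a core schedule `R` (`ρR(ρ)³ → 0`) and `ρ₀ > 0` such that for `0 < ρ < ρ₀`,
eventually in `m`, for every exact positive translation-invariant ground state of `m+2` bosons the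
reduced pair kernel is `ε`-flat OUTSIDE the core: `|f(z) - f(centre)| ≤ ε` for every `z` in the
cell at torus distance `≥ R(ρ)` from the origin (expected: `|f - c_∞| ≲ a/r` for `a ≪ r ≪ ξ`,
`≲ b/r²`, `b = π^{-3/2}(a/ρ)^{1/2}`, for `r ≫ ξ`; no `log L` drift — tadpoles finite). -/
def TailFlatness : Prop :=
  ∀ v : ℝ → ℝ≥0∞, IsRepulsiveFiniteRange v → (∃ M : NNReal, ∀ r, v r ≤ M) → ∀ ε : ℝ, 0 < ε →
    ∃ R : ℝ → ℝ, IsCoreSchedule R ∧ ∃ ρ₀ : ℝ, 0 < ρ₀ ∧ ∀ ρ : ℝ, 0 < ρ → ρ < ρ₀ →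
      ∀ᶠ m : ℕ in atTop, ∀ Ψ : PeriodicTrialState (m + 2) (sideLength ρ (m + 2)),
        IsPosTIGroundState v ρ m Ψ →
        ∀ z ∈ cell (sideLength ρ (m + 2)), R ρ ≤ torusNorm (sideLength ρ (m + 2)) z →
          |pairFn ρ m Ψ z - pairFn ρ m Ψ (centre (sideLength ρ (m + 2)))| ≤ ε

/-- **Stub C — core smallness (ultraviolet half).** For bounded admissible `v`, `ε > 0` and EVERY
core schedule `R` (`ρR(ρ)³ → 0`) there is `ρ₀ > 0` such that for `0 < ρ < ρ₀`, eventually in `m`,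
for every exact positive translation-invariant ground state the reduced pair kernel carries at most
`ε` of `L¹`-mass per particle INSIDE the core: `ρ ∫_{cell ∩ {torus distance < R(ρ)}} |f - f(centre)| ≤ ε`
(stated as a lower Lebesgue integral, so no integrability side condition; expected size
`ρ(a³‖u₂‖_∞ + aR² + bR) → 0`). -/
def CoreSmallness : Prop :=
  ∀ v : ℝ → ℝ≥0∞, IsRepulsiveFiniteRange v → (∃ M : NNReal, ∀ r, v r ≤ M) → ∀ ε : ℝ, 0 < ε →
    ∀ R : ℝ → ℝ, IsCoreSchedule R → ∃ ρ₀ : ℝ, 0 < ρ₀ ∧ ∀ ρ : ℝ, 0 < ρ → ρ < ρ₀ →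
      ∀ᶠ m : ℕ in atTop, ∀ Ψ : PeriodicTrialState (m + 2) (sideLength ρ (m + 2)),
        IsPosTIGroundState v ρ m Ψ →
        ENNReal.ofReal ρ *
            (∫⁻ z in {z | torusNorm (sideLength ρ (m + 2)) z < R ρ} ∩ cell (sideLength ρ (m + 2)),
              ‖pairFn ρ m Ψ z - pairFn ρ m Ψ (centre (sideLength ρ (m + 2)))‖ₑ) ≤
          ENNReal.ofReal ε

/-! ## Registered stubs -/

/-- stub R: Hoeffding reduction to a continuous function of the separation (provable now). -/
theorem stub_hoeffdingReduction : HoeffdingReduction := by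
  sorry

/-- stub T: `ε`-flatness of the reduced pair kernel outside a sub-interparticle core (hardest). -/
theorem stub_tailFlatness : TailFlatness := by
  sorry

/-- stub C: `ρ·L¹`-smallness of the reduced pair kernel inside any sub-interparticle core. -/
theorem stub_coreSmallness : CoreSmallness := by
  sorry

/-! ## Name-keyed aliases of the stub statements — the hypotheses of `PairKernelSplit_of`

(`__Registered.stub_X` is the statement of `stub_X` under that name, `rfl`-equal to it; the device
of `Cruxes/AmplitudeLDP/Lines/birth.lean`, so that the native skeleton audit keys the hypotheses of
the composition to the registered stubs.) -/
namespace __Registered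

/-- Alias of `HoeffdingReduction` keyed by the registered stub name. -/
abbrev stub_hoeffdingReduction : Prop := HoeffdingReduction
/-- Alias of `TailFlatness` keyed by the registered stub name. -/
abbrev stub_tailFlatness : Prop := TailFlatness
/-- Alias of `CoreSmallness` keyed by the registered stub name. -/
abbrev stub_coreSmallness : Prop := CoreSmallness

end __Registered

/-! ## Elementary facts about the clamp split (no sorry) -/

/-- `|clamp_ε t| ≤ ε`. -/
theorem abs_tailPart_le {ε : ℝ} (hε : 0 ≤ ε) (g : Space → ℝ) (c : ℝ) (y : Space) :
    |tailPart ε g c y| ≤ ε := by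
  unfold tailPart
  rw [abs_le]
  exact ⟨le_max_left _ _, max_le (by linarith) (min_le_left _ _)⟩

/-- The excess over level `ε` vanishes where `|f - c| ≤ ε`. -/
theorem corePart_eq_zero {ε : ℝ} {g : Space → ℝ} {c : ℝ} {y : Space} (h : |g y - c| ≤ ε) :
    corePart ε g c y = 0 := by
  unfold corePart tailPart
  rw [abs_le] at h
  rw [min_eq_right h.2, max_eq_right h.1, sub_self]

/-- The excess over level `ε` is dominated by `|f - c|`. -/
theorem abs_corePart_le {ε : ℝ} (hε : 0 ≤ ε) (g : Space → ℝ) (c : ℝ) (y : Space) :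
    |corePart ε g c y| ≤ |g y - c| := by
  unfold corePart tailPart
  generalize g y - c = t
  rcases le_total t ε with h1 | h1 <;> rcases le_total (-ε) t with h2 | h2
  · rw [min_eq_right h1, max_eq_right h2, sub_self, abs_zero]
    exact abs_nonneg _
  · rw [min_eq_right h1, max_eq_left h2, abs_of_nonpos (by linarith : t - -ε ≤ 0),
      abs_of_nonpos (by linarith : t ≤ 0)]
    linarith
  · rw [min_eq_left h1, max_eq_right (by linarith : -ε ≤ ε), abs_of_nonneg (by linarith : 0 ≤ t - ε),
      abs_of_nonneg (by linarith : 0 ≤ t)]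
    linarith
  · have ht : t = 0 := by linarith
    have hε0 : ε = 0 := by linarith
    subst ht
    subst hε0
    simp

/-- Continuity of the clamp. -/
theorem continuous_tailPart (ε : ℝ) {g : Space → ℝ} (hg : Continuous g) (c : ℝ) :
    Continuous (tailPart ε g c) :=
  continuous_const.max (continuous_const.min (hg.sub continuous_const))

/-- Continuity of the excess. -/
theorem continuous_corePart (ε : ℝ) {g : Space → ℝ} (hg : Continuous g) (c : ℝ) :
    Continuous (corePart ε g c) :=
  (hg.sub continuous_const).sub (continuous_tailPart ε hg c)

/-- The torus distance from the origin is continuous. -/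
theorem continuous_torusNorm (L : ℝ) : Continuous (torusNorm L) := by
  have h : Continuous fun z : Space => infDist z (corners L) := continuous_infDist_pt (corners L)
  exact h

/-- The core region `{torus distance < R}` is measurable (open). -/
theorem measurableSet_core (L R : ℝ) : MeasurableSet {z : Space | torusNorm L z < R} :=
  (isOpen_lt (continuous_torusNorm L) continuous_const).measurableSet

/-! ## Composition: the crux BY NAME from the three stub statements (no `sorry` below) -/

/-- **PairKernelSplit_of** — reduction (R) × tail flatness (T) × core smallness (C) ⟹
`PairKernelSplit`. Given `ε`, take the core schedule `R` and `ρ₀ᵀ` of (T), feed `R` to (C) for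
`ρ₀ᶜ`, `ρ₀ := min`; eventually in `m` both hold. For an exact positive translation-invariant ground
state `Ψ` let `f := u_H(·,0)` (continuous, `u_H(x,z) = f(x-z)` by (R)), `c := f(centre)`,
`p := clamp_ε(f - c)` (continuous, `sup |p| ≤ ε` identically) and `w := (f - c) - p` (continuous,
`|w| ≤ |f - c|`, and `w = 0` wherever `|f - c| ≤ ε`, in particular outside the core by (T)); then
`∫_cell |w| = ∫⁻_cell ‖w‖ₑ ≤ ∫⁻_{core ∩ cell} ‖f - c‖ₑ ≤ ε/ρ` by (C), and
`u_H(x,z) = c + p(x-z) + w(x-z)` is the algebraic identity `f = c + p + ((f-c) - p)`. -/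
theorem PairKernelSplit_of (hR : __Registered.stub_hoeffdingReduction)
    (hT : __Registered.stub_tailFlatness) (hC : __Registered.stub_coreSmallness) :
    Summit.AtomisticToContinuum.BoseEinsteinCondensation.Theses.BECRiccatiGhostPlasma.PairKernelSplit := by
  intro v hv hbdd ε hε
  obtain ⟨R, hRsched, ρ₁, hρ₁, HT⟩ := hT v hv hbdd ε hε
  obtain ⟨ρ₂, hρ₂, HC⟩ := hC v hv hbdd ε hε R hRsched
  refine ⟨min ρ₁ ρ₂, lt_min hρ₁ hρ₂, fun ρ hρ hρlt => ?_⟩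
  filter_upwards [HT ρ hρ (lt_of_lt_of_le hρlt (min_le_left _ _)),
    HC ρ hρ (lt_of_lt_of_le hρlt (min_le_right _ _))] with m hTm hCm
  intro Ψ hE hpos hTI
  have hGS : IsPosTIGroundState v ρ m Ψ := ⟨hE, hpos, hTI⟩
  obtain ⟨hcont, hred⟩ := hR ρ m Ψ hρ hpos hTI
  refine ⟨pairFn ρ m Ψ (centre (sideLength ρ (m + 2))),
    tailPart ε (pairFn ρ m Ψ) (pairFn ρ m Ψ (centre (sideLength ρ (m + 2)))),
    corePart ε (pairFn ρ m Ψ) (pairFn ρ m Ψ (centre (sideLength ρ (m + 2)))),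
    continuous_tailPart ε hcont _, continuous_corePart ε hcont _,
    fun z => abs_tailPart_le hε.le _ _ z, ?_, ?_⟩
  · -- the core bound `ρ ∫_cell |w| ≤ ε`
    have hw_meas : AEStronglyMeasurable
        (corePart ε (pairFn ρ m Ψ) (pairFn ρ m Ψ (centre (sideLength ρ (m + 2)))))
        (volume.restrict (cell (sideLength ρ (m + 2)))) :=
      (continuous_corePart ε hcont _).aestronglyMeasurable
    -- Bochner integral of `|w|` as a lower Lebesgue integral
    have h1 : (∫ z in cell (sideLength ρ (m + 2)),
        |corePart ε (pairFn ρ m Ψ) (pairFn ρ m Ψ (centre (sideLength ρ (m + 2)))) z|) =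
        (∫⁻ z in cell (sideLength ρ (m + 2)),
          ‖corePart ε (pairFn ρ m Ψ) (pairFn ρ m Ψ (centre (sideLength ρ (m + 2)))) z‖ₑ).toReal := by
      have := integral_norm_eq_lintegral_enorm hw_meas
      simpa only [Real.norm_eq_abs] using this
    -- pointwise on the cell: `‖w‖ₑ ≤ 1_core · ‖f - c‖ₑ` (zero outside the core by (T))
    have h2 : (∫⁻ z in cell (sideLength ρ (m + 2)),
          ‖corePart ε (pairFn ρ m Ψ) (pairFn ρ m Ψ (centre (sideLength ρ (m + 2)))) z‖ₑ) ≤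
        ∫⁻ z in {z | torusNorm (sideLength ρ (m + 2)) z < R ρ} ∩ cell (sideLength ρ (m + 2)),
          ‖pairFn ρ m Ψ z - pairFn ρ m Ψ (centre (sideLength ρ (m + 2)))‖ₑ := by
      refine (setLIntegral_mono' (measurableSet_cell _) fun z hz => ?_).trans
        (setLIntegral_indicator (measurableSet_core (sideLength ρ (m + 2)) (R ρ)) _).le
      by_cases hcore : torusNorm (sideLength ρ (m + 2)) z < R ρ
      · rw [Set.indicator_of_mem (show z ∈ {z | torusNorm (sideLength ρ (m + 2)) z < R ρ} from hcore)]
        simp only [Real.enorm_eq_ofReal_abs]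
        exact ENNReal.ofReal_le_ofReal (abs_corePart_le hε.le _ _ z)
      · have hfar : R ρ ≤ torusNorm (sideLength ρ (m + 2)) z := not_lt.mp hcore
        have hflat := hTm Ψ hGS z hz hfar
        rw [corePart_eq_zero hflat, enorm_zero]
        exact zero_le
    -- (C) and the `ℝ≥0∞ → ℝ` bookkeeping
    have h3 := hCm Ψ hGS
    have h4 : ENNReal.ofReal ρ * (∫⁻ z in cell (sideLength ρ (m + 2)),
          ‖corePart ε (pairFn ρ m Ψ) (pairFn ρ m Ψ (centre (sideLength ρ (m + 2)))) z‖ₑ) ≤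
        ENNReal.ofReal ε :=
      (mul_le_mul' le_rfl h2).trans h3
    have h5 : (ENNReal.ofReal ρ * ∫⁻ z in cell (sideLength ρ (m + 2)),
          ‖corePart ε (pairFn ρ m Ψ) (pairFn ρ m Ψ (centre (sideLength ρ (m + 2)))) z‖ₑ).toReal ≤
        (ENNReal.ofReal ε).toReal :=
      ENNReal.toReal_mono ENNReal.ofReal_ne_top h4
    rw [ENNReal.toReal_mul, ENNReal.toReal_ofReal hρ.le, ENNReal.toReal_ofReal hε.le] at h5
    rw [h1]
    exact h5
  · -- the identity `u_H(x,z) = c + p(x-z) + w(x-z)`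
    intro x z
    show hoeffdingPair ρ m Ψ x z = _
    rw [hred x z]
    unfold corePart
    ring

/-- Wiring check (an `example`, so that `PairKernelSplit_of` stays the only theorem concluding the
crux): the registered stubs feed the composition as stated. -/
example : Summit.AtomisticToContinuum.BoseEinsteinCondensation.Theses.BECRiccatiGhostPlasma.PairKernelSplit :=
  PairKernelSplit_of stub_hoeffdingReduction stub_tailFlatness stub_coreSmallness

/-- The plain-arrow form `<stub sigs> → PairKernelSplit` of the composition (same proof term). -/
example : HoeffdingReduction → TailFlatness → CoreSmallness →
    Summit.AtomisticToContinuum.BoseEinsteinCondensation.Theses.BECRiccatiGhostPlasma.PairKernelSplit :=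
  PairKernelSplit_of

end Summit.AtomisticToContinuum.BoseEinsteinCondensation.Cruxes.PairKernelSplit.Birth

end
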